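import Summits.Ventures.PercRepro.RankLevelSetDepCountGiantA
import Summits.Ventures.PercRepro.RankLevelSetCountBounds

/-!
# PercRepro — S2: THE INDEPENDENT `5`-SETS ARE FEWER THAN `C(n, 5)` BY THE TRIANGLES (p7, gen 4; sub-claim S2; the cell `(21, 7)`)

The set-indexed level count (S2SetCountQ) bounds the rank-`5` sets with exactly `5` elements — the independent
`5`-sets — by `C(n, 5)`, ALL `5`-subsets. Every triangle `T` (a `3`-circuit) and every `2`-subset `P` of `E ∖ T` give a
DEPENDENT `5`-set `T ∪ P`; under (C1) (lines of `≤ 3` points) two distinct triangles share at most one point, so a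
`5`-set contains at most two triangles, and a `5`-set containing two of them is their union. Hence
`#{dependent 5-sets} ≥ s₃·C(n − 3, 2) − C(s₃, 2)`, i.e.

  **`#{independent 5-sets} + s₃·C(n − 3, 2) ≤ C(n, 5) + C(s₃, 2)`** (`ncard_indep_five_add_le`).

At the cell `(21, 7)` (`n = 28`, `s₃ ≤ 17`, `C(25, 2) = 300` per triangle) this removes `≥ 4,964` of the `98,280`
independent `5`-sets the count charged, against an excess of `≈ 3,900` (`1.0148` with every other lever): the cell
closes (S2SetCountQI / S2SharpCoreXQI / S2CellsP21XQI). Axioms: standard.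
-/

open scoped Matroid

namespace PercRepro

namespace S2

open Set Finset

variable {α : Type} {M : Matroid α}

open scoped Classical in
/-- **Two distinct triangles share at most one point** (C1): if two distinct `3`-circuits shared two points `a, b`,
their union would be a `4`-point set of rank `2` (both lie in `cl{a, b}`, by submodularity). -/
theorem card_inter_le_one_of_triangles (hC1 : ∀ L ⊆ M.E, M.eRk L = 2 → L.ncard ≤ 3)
    {T T' : Finset α} (hT : M.IsCircuit (T : Set α)) (hT3 : T.card = 3)
    (hT' : M.IsCircuit (T' : Set α)) (hT'3 : T'.card = 3) (hne : T ≠ T') :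
    (T ∩ T').card ≤ 1 := by
  by_contra hcon
  have hcon' : 1 < (T ∩ T').card := not_le.1 hcon
  have hTE : (T : Set α) ⊆ M.E := hT.subset_ground
  have hT'E : (T' : Set α) ⊆ M.E := hT'.subset_ground
  -- the intersection has exactly two points (three would force `T = T'`)
  have hinter3 : (T ∩ T').card ≤ 3 := (Finset.card_le_card Finset.inter_subset_left).trans hT3.le
  have hinter2 : (T ∩ T').card = 2 := by
    by_contra h3
    have h3' : (T ∩ T').card = 3 := by omega
    have hsub : T ⊆ T' := by
      have : T ∩ T' = T := Finset.eq_of_subset_of_card_le Finset.inter_subset_left (by omega)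
      intro x hx
      rw [← this] at hx
      exact (Finset.mem_inter.1 hx).2
    exact hne (Finset.eq_of_subset_of_card_le hsub (by omega))
  -- the intersection is a proper subset of the circuit `T`, hence independent of rank `2`
  have hIss : ((T ∩ T' : Finset α) : Set α) ⊂ (T : Set α) := by
    rw [Finset.coe_inter]
    refine ⟨Set.inter_subset_left, fun h => ?_⟩
    have : T ⊆ T ∩ T' := by
      intro x hx
      have hx' : x ∈ ((T : Set α) ∩ (T' : Set α)) := h (Finset.mem_coe.2 hx)
      exact Finset.mem_inter.2 ⟨hx, Finset.mem_coe.1 hx'.2⟩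
    have := Finset.card_le_card this
    omega
  have hIind : M.Indep ((T ∩ T' : Finset α) : Set α) := hT.ssubset_indep hIss
  have heI : M.eRk ((T ∩ T' : Finset α) : Set α) = 2 := by
    rw [hIind.eRk_eq_encard, Set.encard_coe_eq_coe_finsetCard, hinter2]
    rfl
  -- the circuits have rank `2`
  have heT : M.eRk (T : Set α) = 2 := by
    have h := hT.eRk_add_one_eq
    rw [Set.encard_coe_eq_coe_finsetCard, hT3] at h
    have h' : M.eRk (T : Set α) + 1 = 2 + 1 := by rw [h]; rfl
    exact WithTop.add_right_cancel (by decide) h'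
  have heT' : M.eRk (T' : Set α) = 2 := by
    have h := hT'.eRk_add_one_eq
    rw [Set.encard_coe_eq_coe_finsetCard, hT'3] at h
    have h' : M.eRk (T' : Set α) + 1 = 2 + 1 := by rw [h]; rfl
    exact WithTop.add_right_cancel (by decide) h'
  -- submodularity: `r(T ∩ T') + r(T ∪ T') ≤ r(T) + r(T')`, so `r(T ∪ T') ≤ 2`
  have hsub := M.eRk_inter_add_eRk_union_le (T : Set α) (T' : Set α)
  rw [← Finset.coe_inter, heI, heT, heT'] at hsub
  have hU2 : M.eRk ((T : Set α) ∪ (T' : Set α)) ≤ 2 := by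
    have h22 : (2 : ℕ∞) + 2 = 2 + 2 := rfl
    exact (WithTop.add_le_add_iff_left (by simp : (2 : ℕ∞) ≠ ⊤)).1 hsub
  have hU2' : (2 : ℕ∞) ≤ M.eRk ((T : Set α) ∪ (T' : Set α)) := by
    rw [← heT]; exact M.eRk_mono Set.subset_union_left
  have hU : M.eRk ((T ∪ T' : Finset α) : Set α) = 2 := by
    rw [Finset.coe_union]; exact le_antisymm hU2 hU2'
  -- but the union has four points
  have hUE : ((T ∪ T' : Finset α) : Set α) ⊆ M.E := by
    rw [Finset.coe_union]; exact Set.union_subset hTE hT'E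
  have h4 := hC1 _ hUE hU
  rw [Set.ncard_coe_finset] at h4
  have := Finset.card_union_add_card_inter T T'
  omega

open scoped Classical in
/-- A `5`-set contains at most two triangles (two distinct triangles sharing `≤ 1` point already fill it). -/
theorem card_filter_triangles_subset_le_two (hC1 : ∀ L ⊆ M.E, M.eRk L = 2 → L.ncard ≤ 3)
    (T3 : Finset (Finset α)) (hT3 : ∀ T ∈ T3, M.IsCircuit (T : Set α) ∧ T.card = 3)
    {B : Finset α} (hB : B.card = 5) :
    (T3.filter (fun T => T ⊆ B)).card ≤ 2 := by
  by_contra hcon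
  have hcon' : 2 < (T3.filter (fun T => T ⊆ B)).card := not_le.1 hcon
  obtain ⟨T₁, hT₁, T₂, hT₂, T₃, hT₃, h12, h13, h23⟩ := Finset.two_lt_card.1 hcon'
  rw [Finset.mem_filter] at hT₁ hT₂ hT₃
  obtain ⟨hT₁c, hT₁3⟩ := hT3 _ hT₁.1
  obtain ⟨hT₂c, hT₂3⟩ := hT3 _ hT₂.1
  obtain ⟨hT₃c, hT₃3⟩ := hT3 _ hT₃.1
  have i12 := card_inter_le_one_of_triangles hC1 hT₁c hT₁3 hT₂c hT₂3 h12
  have i13 := card_inter_le_one_of_triangles hC1 hT₃c hT₃3 hT₁c hT₁3 h13.symm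
  have i23 := card_inter_le_one_of_triangles hC1 hT₃c hT₃3 hT₂c hT₂3 h23.symm
  -- `T₁ ∪ T₂ = B`
  have hu12 : (T₁ ∪ T₂).card = 5 := by
    have h1 := Finset.card_union_add_card_inter T₁ T₂
    have h2 : (T₁ ∪ T₂).card ≤ 5 := hB ▸ Finset.card_le_card (Finset.union_subset hT₁.2 hT₂.2)
    omega
  have hB12 : T₁ ∪ T₂ = B := Finset.eq_of_subset_of_card_le (Finset.union_subset hT₁.2 hT₂.2) (by omega)
  -- `T₃ ⊆ T₁ ∪ T₂` meets each of `T₁, T₂` in `≤ 1` point: `3 ≤ 2`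
  have hT₃sub : T₃ ⊆ (T₃ ∩ T₁) ∪ (T₃ ∩ T₂) := by
    intro x hx
    have hxB : x ∈ B := hT₃.2 hx
    rw [← hB12, Finset.mem_union] at hxB
    rcases hxB with h | h
    · exact Finset.mem_union.2 (Or.inl (Finset.mem_inter.2 ⟨hx, h⟩))
    · exact Finset.mem_union.2 (Or.inr (Finset.mem_inter.2 ⟨hx, h⟩))
  have h1 := Finset.card_le_card hT₃sub
  have h2 := Finset.card_union_le (T₃ ∩ T₁) (T₃ ∩ T₂)
  omega

open scoped Classical in
/-- **The independent `5`-sets against the triangles**: `#{independent 5-sets} + s₃·C(n − 3, 2) ≤ C(n, 5) + C(s₃, 2)`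
(`n = |E|`, `s₃` = the number of `3`-circuits), under (C1). -/
theorem ncard_indep_five_add_le [M.Finite] (hC1 : ∀ L ⊆ M.E, M.eRk L = 2 → L.ncard ≤ 3) :
    {B : Set α | B ⊆ M.E ∧ B.ncard = 5 ∧ M.eRk B = 5}.ncard +
      {C : Set α | M.IsCircuit C ∧ C.ncard = 3}.ncard * (M.E.ncard - 3).choose 2 ≤
      M.E.ncard.choose 5 + ({C : Set α | M.IsCircuit C ∧ C.ncard = 3}.ncard).choose 2 := by
  classical
  set Ef := Matroid.groundF M with hEf
  have hE : (Ef : Set α) = M.E := Matroid.coe_groundF M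
  have hEcard : Ef.card = M.E.ncard := Matroid.card_groundF M
  -- the triangles, as finsets
  set T3 : Finset (Finset α) := (Ef.powersetCard 3).filter (fun C : Finset α => M.IsCircuit (C : Set α)) with hT3def
  have hT3mem : ∀ T ∈ T3, M.IsCircuit (T : Set α) ∧ T.card = 3 := by
    intro T hT
    rw [hT3def, Finset.mem_filter, Finset.mem_powersetCard] at hT
    exact ⟨hT.2, hT.1.2⟩
  have hT3card : T3.card = {C : Set α | M.IsCircuit C ∧ C.ncard = 3}.ncard := by
    rw [← Matroid.card_circF]
    have himg : Matroid.circF M 3 = T3.image (fun s : Finset α => (s : Set α)) := by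
      ext C
      rw [Matroid.mem_circF, Finset.mem_image]
      constructor
      · rintro ⟨hC, hC3⟩
        have hCfin : C.Finite := M.ground_finite.subset hC.subset_ground
        refine ⟨hCfin.toFinset, ?_, by simp⟩
        rw [hT3def, Finset.mem_filter, Finset.mem_powersetCard]
        refine ⟨⟨?_, ?_⟩, by simpa using hC⟩
        · intro x hx
          rw [Set.Finite.mem_toFinset] at hx
          rw [hEf, Matroid.groundF, Set.Finite.mem_toFinset]
          exact hC.subset_ground hx
        · rw [← Set.ncard_eq_toFinset_card C hCfin]; exact hC3
      · rintro ⟨s, hs, rfl⟩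
        obtain ⟨hsc, hs3⟩ := hT3mem s hs
        exact ⟨hsc, by rw [Set.ncard_coe_finset]; exact hs3⟩
    rw [himg, Finset.card_image_of_injective _ Finset.coe_injective]
  -- the pairs `(T, P)`: a triangle and a `2`-subset of `E ∖ T`
  set Pairs : Finset (Σ _ : Finset α, Finset α) := T3.sigma (fun T => (Ef \ T).powersetCard 2) with hPairsdef
  have hPairscard : Pairs.card = T3.card * (Ef.card - 3).choose 2 := by
    rw [hPairsdef, Finset.card_sigma]
    have : ∀ T ∈ T3, ((Ef \ T).powersetCard 2).card = (Ef.card - 3).choose 2 := by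
      intro T hT
      rw [Finset.card_powersetCard]
      have hTE : T ⊆ Ef := by
        rw [hT3def, Finset.mem_filter, Finset.mem_powersetCard] at hT
        exact hT.1.1
      rw [Finset.card_sdiff, Finset.inter_eq_left.2 hTE, (hT3mem T hT).2]
    rw [Finset.sum_congr rfl this, Finset.sum_const, smul_eq_mul]
  -- the dependent and the independent `5`-subsets
  set D5 : Finset (Finset α) := (Ef.powersetCard 5).filter (fun B : Finset α => ¬ M.Indep (B : Set α)) with hD5def
  set I5 : Finset (Finset α) := (Ef.powersetCard 5).filter (fun B : Finset α => M.Indep (B : Set α)) with hI5def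
  have hID : I5.card + D5.card = Ef.card.choose 5 := by
    rw [hI5def, hD5def, Finset.card_filter_add_card_filter_not, Finset.card_powersetCard]
  -- the map `(T, P) ↦ T ∪ P` lands in the dependent `5`-sets
  have hmaps : ∀ x ∈ Pairs, x.1 ∪ x.2 ∈ D5 := by
    intro x hx
    rw [hPairsdef, Finset.mem_sigma, Finset.mem_powersetCard] at hx
    obtain ⟨hx1, hx2, hx2c⟩ := hx
    obtain ⟨hc, h3⟩ := hT3mem _ hx1
    have hx1E : x.1 ⊆ Ef := by
      rw [hT3def, Finset.mem_filter, Finset.mem_powersetCard] at hx1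
      exact hx1.1.1
    have hdisj : Disjoint x.1 x.2 := by
      rw [Finset.disjoint_left]
      intro a ha ha'
      exact (Finset.mem_sdiff.1 (hx2 ha')).2 ha
    rw [hD5def, Finset.mem_filter, Finset.mem_powersetCard]
    refine ⟨⟨Finset.union_subset hx1E (hx2.trans Finset.sdiff_subset), ?_⟩, ?_⟩
    · rw [Finset.card_union_of_disjoint hdisj, h3, hx2c]
    · intro hind
      have : M.Indep (x.1 : Set α) := hind.subset (by rw [Finset.coe_union]; exact Set.subset_union_left)
      exact hc.not_indep this
  -- the fibre over `B` injects into the triangles inside `B`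
  have hfib : ∀ B ∈ D5, (Pairs.filter (fun x => x.1 ∪ x.2 = B)).card ≤ (T3.filter (fun T => T ⊆ B)).card := by
    intro B _
    apply Finset.card_le_card_of_injOn (fun x => x.1)
    · intro x hx
      rw [Finset.mem_coe, Finset.mem_filter] at hx
      rw [Finset.mem_coe, Finset.mem_filter]
      refine ⟨?_, ?_⟩
      · rw [hPairsdef, Finset.mem_sigma] at hx
        exact hx.1.1
      · rw [← hx.2]; exact Finset.subset_union_left
    · intro x hx y hy hxy
      simp only at hxy
      rw [Finset.mem_coe, Finset.mem_filter] at hx hy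
      have hx' := hx.1
      have hy' := hy.1
      rw [hPairsdef, Finset.mem_sigma, Finset.mem_powersetCard] at hx' hy'
      -- `x.2 = B \ x.1 = B \ y.1 = y.2`
      have h2 : x.2 = y.2 := by
        have ex : x.2 = B \ x.1 := by
          rw [← hx.2]
          ext a
          rw [Finset.mem_sdiff, Finset.mem_union]
          constructor
          · intro ha
            exact ⟨Or.inr ha, (Finset.mem_sdiff.1 (hx'.2.1 ha)).2⟩
          · rintro ⟨h, h'⟩
            rcases h with h | h
            · exact absurd h h'
            · exact h
        have ey : y.2 = B \ y.1 := by
          rw [← hy.2]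
          ext a
          rw [Finset.mem_sdiff, Finset.mem_union]
          constructor
          · intro ha
            exact ⟨Or.inr ha, (Finset.mem_sdiff.1 (hy'.2.1 ha)).2⟩
          · rintro ⟨h, h'⟩
            rcases h with h | h
            · exact absurd h h'
            · exact h
        rw [ex, ey, hxy]
      exact Sigma.ext hxy (heq_of_eq h2)
  -- a `5`-set contains `≤ 2` triangles, and the ones with two are their union
  have htri : ∀ B ∈ D5, (T3.filter (fun T => T ⊆ B)).card ≤ 2 := by
    intro B hB
    rw [hD5def, Finset.mem_filter, Finset.mem_powersetCard] at hB
    exact card_filter_triangles_subset_le_two hC1 T3 hT3mem hB.1.2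
  have htwo : (D5.filter (fun B => (T3.filter (fun T => T ⊆ B)).card = 2)).card ≤ T3.card.choose 2 := by
    rw [← Finset.card_powersetCard 2 T3]
    apply Finset.card_le_card_of_injOn (fun B => T3.filter (fun T => T ⊆ B))
    · intro B hB
      rw [Finset.mem_coe, Finset.mem_filter] at hB
      rw [Finset.mem_coe, Finset.mem_powersetCard]
      exact ⟨Finset.filter_subset _ _, hB.2⟩
    · intro B hB B' hB' hBB'
      simp only at hBB'
      rw [Finset.mem_coe, Finset.mem_filter] at hB hB'
      have hB5 : B.card = 5 := by
        have := hB.1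
        rw [hD5def, Finset.mem_filter, Finset.mem_powersetCard] at this
        exact this.1.2
      have hB'5 : B'.card = 5 := by
        have := hB'.1
        rw [hD5def, Finset.mem_filter, Finset.mem_powersetCard] at this
        exact this.1.2
      obtain ⟨T₁, T₂, hne, hpair⟩ := Finset.card_eq_two.1 hB.2
      have hT₁ : T₁ ∈ T3.filter (fun T => T ⊆ B) := by rw [hpair]; simp
      have hT₂ : T₂ ∈ T3.filter (fun T => T ⊆ B) := by rw [hpair]; simp
      have hT₁' : T₁ ∈ T3.filter (fun T => T ⊆ B') := by rw [← hBB']; exact hT₁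
      have hT₂' : T₂ ∈ T3.filter (fun T => T ⊆ B') := by rw [← hBB']; exact hT₂
      rw [Finset.mem_filter] at hT₁ hT₂ hT₁' hT₂'
      obtain ⟨hc1, h31⟩ := hT3mem _ hT₁.1
      obtain ⟨hc2, h32⟩ := hT3mem _ hT₂.1
      have hi := card_inter_le_one_of_triangles hC1 hc1 h31 hc2 h32 hne
      have hu := Finset.card_union_add_card_inter T₁ T₂
      have e1 : T₁ ∪ T₂ = B :=
        Finset.eq_of_subset_of_card_le (Finset.union_subset hT₁.2 hT₂.2) (by omega)
      have e2 : T₁ ∪ T₂ = B' :=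
        Finset.eq_of_subset_of_card_le (Finset.union_subset hT₁'.2 hT₂'.2) (by omega)
      rw [← e1, ← e2]
  -- the double count
  have hsum : Pairs.card ≤ ∑ B ∈ D5, (T3.filter (fun T => T ⊆ B)).card := by
    rw [Finset.card_eq_sum_card_fiberwise hmaps]
    exact Finset.sum_le_sum hfib
  have hsum2 : ∑ B ∈ D5, (T3.filter (fun T => T ⊆ B)).card ≤
      D5.card + (D5.filter (fun B => (T3.filter (fun T => T ⊆ B)).card = 2)).card := by
    calc ∑ B ∈ D5, (T3.filter (fun T => T ⊆ B)).card
        ≤ ∑ B ∈ D5, (1 + if (T3.filter (fun T => T ⊆ B)).card = 2 then 1 else 0) := by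
          apply Finset.sum_le_sum
          intro B hB
          have := htri B hB
          split_ifs with h
          · omega
          · omega
      _ = D5.card + (D5.filter (fun B => (T3.filter (fun T => T ⊆ B)).card = 2)).card := by
          rw [Finset.sum_add_distrib, Finset.sum_const, smul_eq_mul, mul_one, Finset.sum_boole]
          simp
  -- the independent `5`-sets as a set of sets
  have hI5set : {B : Set α | B ⊆ M.E ∧ B.ncard = 5 ∧ M.eRk B = 5}.ncard = I5.card := by
    have himg : {B : Set α | B ⊆ M.E ∧ B.ncard = 5 ∧ M.eRk B = 5} =
        I5.image (fun s : Finset α => (s : Set α)) := by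
      ext B
      rw [Set.mem_setOf_eq, Finset.coe_image, Set.mem_image]
      constructor
      · rintro ⟨hBE, hB5, hBr⟩
        have hBfin : B.Finite := M.ground_finite.subset hBE
        refine ⟨hBfin.toFinset, ?_, by simp⟩
        rw [Finset.mem_coe, hI5def, Finset.mem_filter, Finset.mem_powersetCard]
        refine ⟨⟨?_, ?_⟩, ?_⟩
        · intro x hx
          rw [Set.Finite.mem_toFinset] at hx
          rw [hEf, Matroid.groundF, Set.Finite.mem_toFinset]
          exact hBE hx
        · rw [← Set.ncard_eq_toFinset_card B hBfin]; exact hB5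
        · rw [Set.Finite.coe_toFinset]
          rw [Matroid.indep_iff_eRk_eq_encard_of_finite hBfin, hBr, ← hBfin.cast_ncard_eq, hB5]
          rfl
      · rintro ⟨s, hs, rfl⟩
        rw [Finset.mem_coe, hI5def, Finset.mem_filter, Finset.mem_powersetCard] at hs
        refine ⟨?_, by rw [Set.ncard_coe_finset]; exact hs.1.2, ?_⟩
        · rw [← hE]; exact Finset.coe_subset.2 hs.1.1
        · rw [hs.2.eRk_eq_encard, Set.encard_coe_eq_coe_finsetCard, hs.1.2]
          rfl
    rw [himg, Finset.coe_image, Set.ncard_image_of_injective _ Finset.coe_injective, Set.ncard_coe_finset]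
  rw [hI5set, ← hT3card, ← hEcard]
  have := hPairscard ▸ hsum.trans (hsum2.trans (Nat.add_le_add_left htwo _))
  omega

end S2

end PercRepro
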